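import Mathlib
import Summits.ValiantsHypothesis.ValiantsHypothesis.Theses.RigidityForcesSymmetry
import Summits.ValiantsHypothesis.ValiantsHypothesis.Theorems.RigidityForcesSymmetryRankRigidMinimalReprLaplaceDefs
import Summits.ValiantsHypothesis.ValiantsHypothesis.Theorems.RigidityForcesSymmetryRankRigidMinimalReprLaplaceFiveOnShell
import Summits.ValiantsHypothesis.ValiantsHypothesis.Theorems.RigidityForcesSymmetryRankRigidMinimalReprLaplaceFiveSectorSplit

/-!
# Line `shallow_collision` — REV 5 (= rev 4′ + the k = 4 kernel census and the STAR REDUCTION booked; stubs unchanged): on-shell ✓ · symmetric sector · asymmetric sector at the weight minimum (stmt-ValiantsHypothesis-24813)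

Skeleton line of the crux `Summit.ValiantsHypothesis.ValiantsHypothesis.Theses.RigidityForcesSymmetry.LaplaceOptimalFive`
(`= LaplaceOptimal 5` by `Iff.rfl`: every split decomposition `P₅ = Σ_t u_t ⊗ w_t`, `u_t` read on the slots `S_t`, `w_t` off
them, has Laplace weight `Σ_t |S_t|!·(5−|S_t|)! ≥ 120`).  History: director-valiant g13 R264 (2026-08-28) opened ONE line merging
the crux ideas `twin-span-depth` (val-idea-19 g3) and `doubling-stratum-residue` (val-idea-19 g4); planners val-idea-19 g5 (rev 1–3),
24813-w1 g3 (rev 3′, pen pro tem, R282 (2)(b)), val-idea-19 g7 (rev 4, rev 4′, rev 5; pen per b132 / R282 (2)(c) / R284 (3) / R286 (1) / R292 (6)); critic of record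
val-idea-crit-3 g4.

HONEST LABEL.  `LaplaceOptimalFive` is OPEN · CONTESTED 72/120 (exactly-open at `d = 5`, border-false: weight-108 border family
`LaplaceFiveBorder.laplaceOptimal_five_border`, p629937; `d = 6` exactly FALSE: `LaplaceSixExact.not_laplaceOptimal_six`, weight
648 < 720, p643716).  What is CLOSED: the on-shell case S1 (✓ p652503 `LaplaceFiveOnShell.onShell_five`, val-lit-p4 g14, wired in
rev 3′).  Nothing in this file proves the crux: S2′ and S3′ are SORRIED targets and `LaplaceOptimalFive_of` is the kernel-checked
composition.  `RankRigidMinimalRepr` (18034) does not move.  VP ≠ VNP is NOT proved.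

REV 4 (val-idea-19 g7, 2026-08-28; SIGNATURE-FIRST val-width INBOX 17:44:10Z, crit-3 g4 veto window).  Two decisions of record.
(1) R274 (2)(b) / R280 (1) — option (w): the rev-3 off-shell pair S2 `stub_offShell_oddSurfacing_five` ∘ S3
`stub_depthOneUncancellable_five` is WITHDRAWN from the registered skeleton to the line card's memo (S3 is STUB-MISSTATED of record:
✓ p648754 `…Negative.DepthOnePadding.below96_of_depthOneUncancellable` — its feature premise «some term carries depth-one cut-junk»
is manufactured by an inert cancelling pair at cost 24, so S3 ⊢ the crux on `[72, 96)`; crit-3 g4 adjudication 16:22:41Z; (n) alone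
rejected because the rewriting paddings r1/r2 survive independence normal forms; (q) = a padding-stable quantitative invariant on the
per-flattening junk `J_F` modulo doubly-cylindrical functions is the admission test for a rev 5, not typable honestly today).
(2) The young-shadow SECTOR CUT (val-idea-19 g6, crux idea #6; `laplaceOptimalFive_of_sectors`, ported by 24813-w1 g3 as
`…Theorems.RigidityForcesSymmetryRankRigidMinimalRepr.LaplaceFiveSectorSplit`) becomes the TOP CUT, typed AT THE WEIGHT MINIMUM so
that the asymmetric half passes the padding test.

REV 4′ (val-idea-19 g7, 2026-08-28; MECHANICAL — crit-3 g4 notes 17:49:51Z (b) / 18:02:28Z / 18:17:29Z (b), director R284 (3) / R286 (1);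
SIGNATURE-FIRST val-width INBOX).  No stub is added, removed, renamed or changed in content; sorries = 2 as in rev 4.
(i) BY IMPORT: `SlotInvariantOn` / `SideSymmetric` are now the TREE declarations
`…Theorems.RigidityForcesSymmetryRankRigidMinimalRepr.LaplaceFiveSectorSplit.{SlotInvariantOn, SideSymmetric}` (✓ p654450
`…LaplaceFiveSectorSplitDefs` / ✓ p654812 `…LaplaceFiveSectorSplit`, 24813-w1 g3's port of young-shadow §1); the rev-4 local verbatim
copies are deleted (they agreed by `Iff.rfl`), so S2′/S3′ are stated over the same constants as every Theorems file of the K1 lane, and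
the bundled sector Props are wired BY NAME (all proved, §«By-name compatibility»): `isSplitDecomposition_iff`, `laplaceWeight_eq_weight`,
`S2'_of_K1 : SideSymLaplaceOptimalFive → S2′`, `K1_of_S2' : S2′ → SideSymLaplaceOptimalFive` (through the closed S1),
`S3'_of_K2 : AsymLaplaceOptimalFive → S3′` — so a Theorems proof of `SideSymLaplaceOptimalFive` closes S2′ by a one-line `exact`.
(ii) S2′'s docstring now carries the LOCATED RESIDUAL of the separation mechanism (crit-3 g4 census 18:17:29Z, numbers below) and the
K1 sub-rungs CLOSED BY NAME in Theorems (separation on ≤ 3 pair splits ✓ p654812/p655191/p656331/p656799; the catalecticant step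
✓ p654341/p655587; PROP A ✓ p657029 `LaplaceFivePropA.sideSym_threePairSplits`) — sub-rungs INSIDE S2′, not registered stubs.

REV 5 (val-idea-19 g7, 2026-08-28T19:55:53Z SIGNATURE-FIRST (+19:58Z erratum: Schur totals verified); BOOKKEEPING — director R292 (6); SIGNATURE-FIRST val-width INBOX, crit-3 g4 veto window).  No stub is
added, removed, renamed or changed in content; sorries = 2 as in rev 4/4′.  Booked BY NAME (all `…Theorems.RigidityForcesSymmetryRankRigidMinimalRepr.*`):
(i) THE k = 4 CENSUS ROW IS IN THE KERNEL ON BOTH SIDES.  Separation TRUE on the rigid 4-supports: `LaplaceFiveFourSplitTypes.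
fourSplit_separation_path / _paw / _chair`, `rest3_full` (✓ p657671, val-lit-p4 g14; crit-3 by-name read 19:36:11Z, std axioms),
`LaplaceFiveFourSplit.fourSplit_separation_rigid` (✓ p661673, p4: family form — four distinct pair splits that are neither a star
`K₁,₄` nor a triangle-plus-edge `K₃ ⊔ K₂` nor a 4-cycle `C₄` separate; `family_transport`, `sep4_normalForms`, `classify4_stab01` by
kernel `decide`) and PROP A⁺ ✓ p662460 `LaplaceFivePropA.sideSym_fourPairSplits_rigid (hdec) (hsym) (hpair) (h4 : (T.image S).card = 4)
(hstar) (hiso) (hcyc) : Nat.factorial 5 ≤ laplaceWeight T S` (p4, 19:51Z): together with Prop A (✓ p657029), K1 HOLDS ON EVERY RIGID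
SUPPORT (≤ 3 distinct pair splits, or 4 of type `P₅`-path / paw / chair).  Separation FALSE on the slack 4-supports, with explicit slack
tensors: `LaplaceFiveSectorSplit.not_fourSplit_separation_star / _cycle / _triangleEdge`, `star_slack`, `cycle_slack`,
`triangleEdge_slack₄₁`, `triangleEdge_slack₃₂`, `edge_sideSym` over `LaplaceFiveSectorSplit.{injC, pent, ind0, edgePent, edgePot}` (files `…LaplaceFiveFourSplitSlack{Defs,}`)
(✓ p658198 / ✓ p658812, 24813-w1 g3; crit-3 by-name read 19:36:11Z), and the COHERENCE laws `LaplaceFiveSectorSplit.{exchange,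
slotInvariantOn_comp, sideSym_comp, image_pair_swap, star_coherence, triangleEdge_coherence, cycle_antipodal_coherence}` (file `…LaplaceFiveSlackCoherence`, ✓ p659292 /
✓ p659453, w1: on `K₁,₄` the four shadows are fully symmetric up to slot-conjugates of ONE tensor and `Z₁ + (ab)•Z₁ + (ac)•Z₁ + (ad)•Z₁`
is fully symmetric; the `C₄` adjacent relation and the `K₃ ⊔ K₂` triangle↔edge link are NOT yet claimed).  w1 g3 Census 3 (memo
`NOTE-w1g3-24813-split-separation-census.md`, evidence on 24813): mixed slice/pair supports are rigid except the first slack at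
`{p},{q},{pq}` / `{p},{qr},{st}` / five slices (4/224 classes each).
(ii) THE STAR REDUCTION (24813-w1 g3 memo `NOTE-w1g3-24813-star-K1-reduction.md` 19:30Z and pen note `NOTE-g7-24813-star-closed-rays.md`
(sha16 9224802ea231c8e5), both evidence on 24813, reached independently; crit-3 g4 exact confirmations 19:31:06Z / 19:36:11Z).  In the
symmetric sector read short factors as quadrics and long factors as cubics in the five letters; `Sym²⊗Sym³ = S₍₅₎ ⊕ S₍₄,₁₎ ⊕ S₍₃,₂₎`
(126 + 224 + 175 = 525; `S₍₃,₂₎ = ker L`, `L(u⊗w) = Σᵢ eᵢ ⊗ (∂ᵢu)·w : Sym²⊗Sym³ → V⊗Sym⁴` onto, rank 350).  `star_coherence` says exactly: a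
side-symmetric decomposition on the star with hub `p` IS a tuple (f₁,…,f₄; E) of quintics with `Σ f_a = x₀x₁x₂x₃x₄` and ONE common
`E ∈ S₍₃,₂₎`, the ray on `{p,a}` being the slot-transport of `Cat₂,₃ f_a + E` (so `n_a ≥ rank(Cat₂,₃ f_a + E)`), and conversely (w1:
the star relation kills the transported slack in the sum).  The relation moduli are WEIGHT-GRADED: w1's per-content-class star slack is
the weight multiplicity of the Schur module — `slack(K₁,₄, O_μ) = K₍₃,₂₎,μ⁺` (Kostka): 5 on the injective class, non-zero on exactly the
101/126 classes with `μ⁺ ⊴ (3,2)`, total `175 = dim S₍₃,₂₎(ℂ⁵)` (= val-lit-p4 g14's all-content count 19:53:31Z); the census rows `C₄`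
(4; 121/126) and `K₃ ⊔ K₂` (9; 121/126) are likewise the multiplicities of `S₍₄,₁₎(ℂ⁵)` (total 224) and `S₍₄,₁₎ ⊕ S₍₃,₂₎` (total 399), and
the rigid `P₅` has slack 0 in every class — all four VERIFIED class by class (pen `g7/slackschur.py`, pure python, exact rank mod 2⁶¹−1,
seconds): the relation moduli of the three slack 4-supports are the Schur modules `S₍₃,₂₎`, `S₍₄,₁₎`, `S₍₄,₁₎ ⊕ S₍₃,₂₎` of the letter
space.  Hence K1-on-the-star ⟺ ∀ (f, E): `Σ_a rank(Cat₂,₃ f_a + E) ≥ 10`; `E = 0`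
is catalecticant subadditivity (Prop A's engine ✓ p654341).  Exact facts of record: the ONE-FLATTENING bound `Σ ≥ rank(Cat m + 4E)`
is DEAD — the explicit `E*` of weight (1,1,1,1,1) (that weight space of `S₍₃,₂₎` is the 5-dimensional space of edge weights on `K₅`
with zero vertex sums; `E*` = the `K₂,₃` pattern) gives `rank(Cat m + E*) = 4` (pen, crit-3 confirmed); a proof must use the FOUR-WAY
splitting with the common `E`.  The pen note carries the ray-closedness dictionary (`star_coherence` conjunct 4 ⟺ the ray 1-form
`Σ_t w_t du_t` is exact), the closed-completion table, and an ARCHITECTURE L1–L5: a one-term ray forces `E = 0` (L1, closed rank-1 =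
Veronese `ℓ²⊗ℓ³`, proved on paper) so only the profiles (2,2,2,2) and (3,2,2,2) remain; a closed rank-2 ray has a square `ℓ²` in its
quadric pencil and the shape `αℓ²⊗ℓ³ + β(ℓ²⊗ℓq + ⅔ q⊗ℓ³)` or is binary (L2 — THE OPEN ALGEBRA, unrefuted on 150 structured pencils);
the common `E` then has a linear gcd `ℓ₀` of its long factors and the last ray has rank `≥ rank(Cat m mod (ℓ₀·Sym² + Sym³W)) ≥ 4 > 3`
(L3–L5, exact counts 4/7/9/10 by `|supp ℓ₀|`, confirmed by crit-3).  Nothing of this is a theorem in the tree yet.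
(iii) NEXT RUNG OF S2′ NAMED (pen 19:24:16Z; crit-3 g4 no objection 19:26:06Z; director R292 (6)): `LaplaceFivePropA.sideSym_starPairSplits
(N T S u w) (hdec : IsSplitDecomposition T S u w) (hsym : SideSymmetric T S u w) (hpair : ∀ t ∈ T, (S t).card = 2) (p : Fin 5)
(hstar : ∀ t ∈ T, p ∈ S t) : Nat.factorial 5 ≤ laplaceWeight T S` — K1 restricted to star-contained supports (its new content is the
4-ray case with the `(3,2)`-slack; ≤ 3 rays is Prop A); first prover file of the successor lane, SIGNATURE-FIRST to crit-3; then `C₄`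
and `K₃ ⊔ K₂` (coherence laws in hand), then ≥ 5 splits.  SIZING OF RECORD for the next hand (p4 19:53:31Z, not filed): (A) on INJECTIVE
content the star closes by an elementary multiplicity count (`|T| ≥ 16`) GIVEN a junk clause; (B) the obstruction is the NON-injective
content (the other 170 coordinates of `E`) — successor shapes: `sideSym_starPairSplits_injective` (extra depth-one vanishing clause,
S1-style) then the junk clause, or the rank form (ii), which carries all contents at once.  Hands (R292 (6)): 24813-w1 g3 CLOSED 19:34Z and val-lit-p4 g14 closing ≈21:14Z
(deliveries above); pen val-idea-19 g7 (the crux-dir pen reverts to val-port-1 g3 for δ-wires if this seat's wall intervenes);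
val-neg-2 g2 j315882 C6-calibration queued with sealed PRED.

ARCHITECTURE (rev 4).  A term system is SIDE-SYMMETRIC (`SideSymmetric`, the sector-split port's declaration) when every short factor
`u_t` is invariant under the permutations of the slots of `S_t` and every long factor under those of `S_tᶜ`; it is ON-SHELL on `T`
(`OnShell`, rev 3) when the factors vanish off injective short/long words and depend only on the letter SET read — ON-SHELL ⟹
SIDE-SYMMETRIC (`sideSymmetric_of_onShell`, proved), so S1 sits inside the symmetric sector.  A profile `(T, S)` is WEIGHT-MINIMAL
(`WeightMinimal`) when no exact cylindrical term system for `P₅` on any profile is cheaper.  The composition `LaplaceOptimalFive_of`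
is a MINIMAL-COUNTEREXAMPLE argument (`Nat.find` on the weights realised by exact cylindrical systems): a weight-minimal exact system
`X₀` exists and is cheaper than the given one; then
* `X₀` on-shell ⟶ S1 `stub_onShell_five` (CLOSED ✓ p652503);
* `X₀` side-symmetric, off-shell ⟶ S2′ `stub_sideSym_offShell_five` (= young-shadow K1 `SideSymLaplaceOptimalFive` with the closed
  on-shell case carved out; `sideSymLO5_of_S1_S2'` / `S2'_of_sideSymLO5` / `K1_of_S2'` / `S2'_of_K1` prove the equivalence given S1;
  sub-rungs of record (rev 4′ bookkeeping, all in `…Theorems.RigidityForcesSymmetryRankRigidMinimalRepr.*`): SEPARATION on ≤ 3 distinct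
  pair splits ✓ — `LaplaceFiveSectorSplit.twoSplit_separation` (✓ p654812, w1), `LaplaceFiveTriangleSeparation.threeSplit_separation_triangle`
  (✓ p655191, p4), `LaplaceFiveThreeSplitTypes.threeSplit_separation_{star,path,pathEdge}` (✓ p656331, p4), `LaplaceFiveThreeSplit.threeSplit_separation`
  (✓ p656799, p4 — young-shadow `stub_threeSplit_separation` VERBATIM), helper `LaplaceFiveSectorSplit.full_of_crossSwap` /
  `threeSplit_separation_of_not_triangle` (✓ p656592, w1); CATALECTICANT ✓ — `LaplaceFiveSymmetricPieces.symmetricPieces_needTen`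
  (✓ p654341, p4: fully symmetric pair-split pieces need ≥ 10 terms, tight) and `LaplaceFiveTriangleSeparation.sideSym_triangle_ten_le`
  (✓ p655587); PROP A = S2′ on pair profiles with ≤ 3 distinct splits ✓ p657029 `LaplaceFivePropA.sideSym_threePairSplits` (p4, 18:26:51Z;
  = young-shadow `stub_sideSym_threePairSplits` VERBATIM over the ported defs); PROP A⁺ = S2′ on pair profiles with exactly 4 distinct
  splits of rigid type (`P₅`-path / paw / chair) ✓ p662460 `LaplaceFivePropA.sideSym_fourPairSplits_rigid` over ✓ p661673
  `LaplaceFiveFourSplit.fourSplit_separation_rigid` and ✓ p657671 `LaplaceFiveFourSplitTypes` (p4, rev 5); OPEN inside S2′ = the SLACK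
  supports `K₁,₄` / `C₄` / `K₃ ⊔ K₂` / ≥ 5 splits (S2′'s docstring: located residual, slack and coherence theorems ✓ p658198 / p658812 /
  p659292 / p659453, the STAR REDUCTION, and the named next rung `LaplaceFivePropA.sideSym_starPairSplits`); instruments of record:
  val-lit-p4 g14 (Prop A / A⁺ lane, nine files ✓, seat closing 19:52Z), 24813-w1 g3 (4-split slack side, CLOSED 19:34Z));
* `X₀` not side-symmetric ⟶ S3′ `stub_minimalAsym_five` (RESIDUAL LAW, honestly labelled: the crux's asymmetric sector at the weight
  minimum; no mechanism claimed; 0 provers; `S3'_of_asymLO5` shows young-shadow K2 `AsymLaplaceOptimalFive` discharges it by name).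
All three registered stubs are load-bearing; sorries = 2 (S2′, S3′).

PADDING TEST OF RECORD (R274 (2) rule; crit-3's paddings t± (inert cancelling pair, +24), r1 (`f⊗g ↦ f⊗(g+h) + (−f)⊗h`, +12), r2
(net cut-junk through a doubly-cylindrical function written on two splits, +24), and block gauge `(u,w) ↦ (uA, A⁻¹w)` at cost 0).
S2′: `SideSymmetric` (∀ t ∈ T) cannot be manufactured by adding terms; `¬ OnShell` CAN be manufactured inside the symmetric sector by
the symmetric off-shell inert pair `±[v₀ = v₁] ⊗ 1`, so S2′ ⊢ «symmetric ON-shell systems have weight ≥ 96» — strictly below the CLOSED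
S1 (≥ 120): no costume content, S2′ ∧ S1 ⟺ K1.  S3′: `WeightMinimal` is destroyed by every weight-raising padding (t±, r1, r2), and at
a weight-minimal system every block `Σ_{t on F} u_t ⊗ w_t` has full rank `m_F` (else two terms merge and the weight drops), so block
gauge preserves `span{u_t : t on F}` and cannot create a non-symmetric factor: S3′ passes all four.  What S3′ lacks is a why-easier —
hence the RESIDUAL label.  (The costume-on-`[72,96)` defect of the UNRESTRICTED asymmetric sector, recorded in the sector-split port's
docstring of `AsymLaplaceOptimalFive`, is exactly what typing at the minimum removes.)

CALIBRATION KNIVES (crit-3 g4, mandatory) — the finding behind decision (2): THE SECTOR CUT FACTORISES THE TWO KNIVES.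
* SIGN knife (`Negative.SignBlindBarrier`, ✓ p650988: a bound valid for every ±1 sign pattern on the injective words is ≤ 72; the
  determinant pattern `D₅` has weight exactly 72, `SignPatternCheap.sign_five_cheap` ✓ p646934, floor attained per val-neg-2 j313291).
  `D₅` admits NO side-symmetric split decomposition at all: a side-symmetric term on a split `S` is invariant under a slot
  transposition inside `S` or `Sᶜ` (one side has ≥ 2 slots), so the `S₅`-sign projector kills it, while it fixes `D₅`.  Hence the
  `D₅`-instance of S2′ is VACUOUS — the symmetric sector is invisible to the sign knife — and the `D₅`-instance of S3′ is FALSE (the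
  weight-72 minimizers of `D₅` are necessarily asymmetric): S3′ carries the whole sign knife, S2′ none of it.  Neither stub is uniform
  in the sign pattern, as `signBlind_le_72` demands of anything above 72.
* PARITY knife (`d = 6`: `LaplaceSixExact.not_laplaceOptimal_six`, weight 648 < 720).  The 648 design is SIDE-SYMMETRIC (all its
  factors are letter-set / arrangement indicators and diagonal cleaners `[v₀=v₁=x]`, symmetric on their sides) and OFF-shell (the
  cleaners are non-zero on the non-injective short word `(x,x)`): the `d = 6` analogue of S2′ is FALSE — S2′ is the step that must see
  «5 is odd» (young-shadow: through the relation count of Young-invariant vectors, none on ≤ 3 pair splits at `d = 5`) — while the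
  `d = 6` analogue of S3′ has its hypothesis `¬ SideSymmetric` unmet by the 648 design, is NOT contradicted, and is plausibly true
  (even `d`: cheapness lives in the symmetric sector).  So S2′ faces the parity knife alone and S3′ the sign knife alone.

FOLDED RECORDS (R282 (2)).  S1 ✓ p652503 (13-file chain `…LaplaceFiveOnShell*`, crit-3 by-name read 17:31:35Z, std axioms).
Rung R1 = the unit-tilings trilogy ✓ p649601 / p650270 / p651416 (24813-w1 g3; `card_tilings = 520`, six families F1–F6) WITH crit-3's
caveat: the census does NOT yield «≤ 9 terms ⇒ two letter-sharing blocks on one split» by pigeonhole — no stub below uses it.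
val-neg-2 g2 read-outs (i)/(ii)/(iv) PRED HOLDS; ✓ p650668 `Negative.LaplaceFiveBorderResidual`; kit j313482 (F3-sym floor 5/5: no
symmetric-sector border obstruction at that resolution ⇒ S2′ is plausibly border-TRUE, which is what makes CLOSED tools legitimate
there — S2′'s why-easier).  stmt-27319 `LaplaceOptimalFourFive` REFUTED — nothing here lifts from `P₄,₅`.
-/

set_option linter.dupNamespace false
set_option linter.style.longLine false
set_option autoImplicit false

open Finset
open Summit.ValiantsHypothesis.ValiantsHypothesis.Theorems.RigidityForcesSymmetryRankRigidMinimalRepr (LaplaceOptimal)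

namespace Summit.ValiantsHypothesis.ValiantsHypothesis.Cruxes.LaplaceOptimalFive.ShallowCollision

/-! ### Vocabulary (copied VERBATIM from val-idea-19 g4's `DoublingStratumResidueSketch.lean`, namespace
`…Cruxes.LaplaceOptimalFive.DoublingStratumResidue`; restated here because `Cruxes/` workfiles are not importable on the farm
snapshot — `lean check` answers `remote:stale:unbuilt` for them — so the line must be self-contained.  Same names, same bodies.) -/

/-- The two cylinder conditions of `LaplaceOptimal 5` for a term system `(S, u, w)` (g4). -/
def Cylindrical {N : ℕ} (S : Fin N → Finset (Fin 5)) (u w : Fin N → (Fin 5 → Fin 5) → ℂ) : Prop :=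
  (∀ t, ∀ v v' : Fin 5 → Fin 5, (∀ i ∈ S t, v i = v' i) → u t v = u t v') ∧
  (∀ t, ∀ v v' : Fin 5 → Fin 5, (∀ i, i ∉ S t → v i = v' i) → w t v = w t v')

/-- Laplace weight of the profile (g4). -/
def weight {N : ℕ} (T : Finset (Fin N)) (S : Fin N → Finset (Fin 5)) : ℕ :=
  ∑ t ∈ T, (S t).card.factorial * (5 - (S t).card).factorial

/-- ON-SHELL factors, g4's WHOLE-SYSTEM form (all `t : Fin N`; `DoublingStratumResidue.OnShell` verbatim): `u t` vanishes
unless `v` is injective on `S t` and depends only on the SET `v '' (S t)` (symmetric, square-free), and likewise `w t` on the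
complement.  All certified cheap mechanisms (d = 4, 5, 6 border, d = 6 exact) use OFF-shell factors (`e₀₃`, `e₀₂ − e₂₀`, diagonal
killers).  Kept for the bridge lemmas below; the line's case split uses the RELATIVISED predicate `OnShell T S u w`. -/
def OnShellAll {N : ℕ} (S : Fin N → Finset (Fin 5)) (u w : Fin N → (Fin 5 → Fin 5) → ℂ) : Prop :=
  (∀ t v, ((S t).image v).card < (S t).card → u t v = 0) ∧
  (∀ t v v', (S t).image v = (S t).image v' → u t v = u t v') ∧
  (∀ t v, (((S t)ᶜ).image v).card < ((S t)ᶜ).card → w t v = 0) ∧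
  (∀ t v v', ((S t)ᶜ).image v = ((S t)ᶜ).image v' → w t v = w t v')

/-- ON-SHELL ON `T` (rev 3, crit-3 g4 price P1, vw l.1721): the four clauses relativised to the terms `t ∈ T` that exactness and
weight actually see.  With the whole-system form, `¬ OnShell` could be witnessed by a term OUTSIDE `T`, and S2 would silently
contain S1's cheap case; with this form the off-shell witness lives in `T`.  S1 loses nothing (zero-truncation off `T`:
`onShell_five_of_onShellAll_five` below), S3 is untouched, the composition script is unchanged. -/
def OnShell {N : ℕ} (T : Finset (Fin N)) (S : Fin N → Finset (Fin 5)) (u w : Fin N → (Fin 5 → Fin 5) → ℂ) : Prop :=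
  (∀ t ∈ T, ∀ v, ((S t).image v).card < (S t).card → u t v = 0) ∧
  (∀ t ∈ T, ∀ v v', (S t).image v = (S t).image v' → u t v = u t v') ∧
  (∀ t ∈ T, ∀ v, (((S t)ᶜ).image v).card < ((S t)ᶜ).card → w t v = 0) ∧
  (∀ t ∈ T, ∀ v v', ((S t)ᶜ).image v = ((S t)ᶜ).image v' → w t v = w t v')

/-- The whole-system form implies the relativised one (trivial direction). -/
theorem onShell_of_onShellAll {N : ℕ} (T : Finset (Fin N)) (S : Fin N → Finset (Fin 5))
    (u w : Fin N → (Fin 5 → Fin 5) → ℂ) (h : OnShellAll S u w) : OnShell T S u w :=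
  ⟨fun t _ v hv => h.1 t v hv, fun t _ v v' hv => h.2.1 t v v' hv,
   fun t _ v hv => h.2.2.1 t v hv, fun t _ v v' hv => h.2.2.2 t v v' hv⟩

/-- Bridge (proved, rev 3; moved above S1 in rev 3′ to wire the closer): the relativised S1 is EQUIVALENT in content to g4's whole-system K2 — zero-truncating a term
system off `T` makes it on-shell and cylindrical everywhere without changing exactness or weight.  So a prover may close S1 in
either form: this lemma converts a proof of the whole-system form (`OnShellAll`, g4 K2 verbatim) into `stub_onShell_five`. -/
theorem onShell_five_of_onShellAll_five
    (hK2 : ∀ (N : ℕ) (T : Finset (Fin N)) (S : Fin N → Finset (Fin 5)) (u w : Fin N → (Fin 5 → Fin 5) → ℂ),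
      Cylindrical S u w → OnShellAll S u w →
      (∀ v : Fin 5 → Fin 5, (∑ t ∈ T, u t v * w t v) = if Function.Injective v then 1 else 0) →
      Nat.factorial 5 ≤ weight T S) :
    ∀ (N : ℕ) (T : Finset (Fin N)) (S : Fin N → Finset (Fin 5)) (u w : Fin N → (Fin 5 → Fin 5) → ℂ),
      Cylindrical S u w → OnShell T S u w →
      (∀ v : Fin 5 → Fin 5, (∑ t ∈ T, u t v * w t v) = if Function.Injective v then 1 else 0) →
      Nat.factorial 5 ≤ weight T S := by
  classical
  intro N T S u w hcyl hon hid
  -- zero-truncation off `T`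
  let u' : Fin N → (Fin 5 → Fin 5) → ℂ := fun t v => if t ∈ T then u t v else 0
  let w' : Fin N → (Fin 5 → Fin 5) → ℂ := fun t v => if t ∈ T then w t v else 0
  have hu' : ∀ t v, u' t v = if t ∈ T then u t v else 0 := fun _ _ => rfl
  have hw' : ∀ t v, w' t v = if t ∈ T then w t v else 0 := fun _ _ => rfl
  refine hK2 N T S u' w' ⟨?_, ?_⟩ ⟨?_, ?_, ?_, ?_⟩ ?_
  · intro t v v' hvv'
    by_cases ht : t ∈ T
    · rw [hu', hu', if_pos ht, if_pos ht]; exact hcyl.1 t v v' hvv'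
    · rw [hu', hu', if_neg ht, if_neg ht]
  · intro t v v' hvv'
    by_cases ht : t ∈ T
    · rw [hw', hw', if_pos ht, if_pos ht]; exact hcyl.2 t v v' hvv'
    · rw [hw', hw', if_neg ht, if_neg ht]
  · intro t v hv
    by_cases ht : t ∈ T
    · rw [hu', if_pos ht]; exact hon.1 t ht v hv
    · rw [hu', if_neg ht]
  · intro t v v' hv
    by_cases ht : t ∈ T
    · rw [hu', hu', if_pos ht, if_pos ht]; exact hon.2.1 t ht v v' hv
    · rw [hu', hu', if_neg ht, if_neg ht]
  · intro t v hv
    by_cases ht : t ∈ T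
    · rw [hw', if_pos ht]; exact hon.2.2.1 t ht v hv
    · rw [hw', if_neg ht]
  · intro t v v' hv
    by_cases ht : t ∈ T
    · rw [hw', hw', if_pos ht, if_pos ht]; exact hon.2.2.2 t ht v v' hv
    · rw [hw', hw', if_neg ht, if_neg ht]
  · intro v
    rw [← hid v]
    refine Finset.sum_congr rfl (fun t ht => ?_)
    rw [hu', hw', if_pos ht, if_pos ht]

/-- [rev 3′: **CLOSED BY NAME** — ✓ p652503 `…Theorems.RigidityForcesSymmetryRankRigidMinimalRepr.LaplaceFiveOnShell.onShell_five`
(val-lit-p4 g14, 13-file chain p648031 … p652503, std axioms; crit-3 g4 kernel read 17:31:35Z), wired through the bridge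
`onShell_five_of_onShellAll_five`; statement byte-identical to rev 3.]
**S1 — `stub_onShell_five` (rung; g4 K2 with `OnShell` relativised to `t ∈ T` — rev 3, equivalent in content by
`onShell_five_of_onShellAll_five`; rank 3 of the line; size M).**  A cylindrical term system, ON-SHELL on `T`, that
reproduces `P₅` exactly has Laplace weight `≥ 120`.  On-shell: `u_t v = 0` unless `v` is injective on `S_t`, and `u_t` depends only
on the letter set `v '' S_t`; same for `w_t` on `S_tᶜ`.  Then `u_t ⊗ w_t` is supported on words injective on both sides of the
split, its junk sits exactly at the cut-collision words of letter blocks `A ⊇≠ ∅ ∩ B` (depth `|A ∩ B| ∈ {1, 2}` for pair terms), and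
the 3 125 equations decouple by depth into the injective block (120), the depth-1 block and the `Δ₅` block — plausibly finite
linear algebra over the `10 + 10` letter blocks per split (why it might close: no cleaning variables exist, so every junk word is a
homogeneous linear condition on block products).  Why it might fail: an on-shell cheap exact identity would be a new honest
mechanism; none is known at any `d`.  d = 6 CALIBRATION: the weight-648 design is OFF-shell as a system — its six cleaners `4·[v₀=v₁=x] ⊗ [Arr((C∖x)²)]` have
DIAGONAL short factors (non-zero on the non-injective short word `(x,x)`, violating the first `OnShell` clause), although its ten
3|3 terms `(N_S + j_S K_S) ⊗ (j_S N_{Sᶜ} + K_{Sᶜ})` are on-shell (they vanish on repeated letters and depend only on the letter set;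
crit-3 g4) — so `not_laplaceOptimal_six` does NOT contradict the d = 6 analogue «on-shell LaplaceOptimal 6», whose status is open.
Consequence for the prover: S1 need not be parity-specific, but a d-UNIFORM proof of S1 proves the d = 6 on-shell statement too —
say so if that is what you have.  Sources: idea card `Ideas/doubling-stratum-residue.md` (K2),
`DoublingStratumResidueSketch.star_at_one`, `starDefect2_on_doubling` (kernel). -/
theorem stub_onShell_five :
    ∀ (N : ℕ) (T : Finset (Fin N)) (S : Fin N → Finset (Fin 5)) (u w : Fin N → (Fin 5 → Fin 5) → ℂ),
      Cylindrical S u w → OnShell T S u w →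
      (∀ v : Fin 5 → Fin 5, (∑ t ∈ T, u t v * w t v) = if Function.Injective v then 1 else 0) →
      Nat.factorial 5 ≤ weight T S :=
  onShell_five_of_onShellAll_five
    Summit.ValiantsHypothesis.ValiantsHypothesis.Theorems.RigidityForcesSymmetryRankRigidMinimalRepr.LaplaceFiveOnShell.onShell_five

/-! ### Rev 4′ vocabulary: the symmetric sector BY IMPORT, and weight-minimality

`SlotInvariantOn A T` (invariance of `T : (Fin 5 → Fin 5) → ℂ` under every slot permutation fixing `Aᶜ` pointwise, action
`(τ • T) v = T (v ∘ τ)`) and `SideSymmetric T S u w` (every short factor `u t`, `t ∈ T`, is `SlotInvariantOn (S t)`, every long factor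
`SlotInvariantOn (S t)ᶜ`) are, from rev 4′ on, the declarations of
`Summit.ValiantsHypothesis.ValiantsHypothesis.Theorems.RigidityForcesSymmetryRankRigidMinimalRepr.LaplaceFiveSectorSplit`
(✓ p654450 / ✓ p654812), opened below together with `IsSplitDecomposition`, `laplaceWeight` and the two sector Props
`SideSymLaplaceOptimalFive` (K1) / `AsymLaplaceOptimalFive` (K2).  Rev 4 carried byte-identical local copies (agreeing by `Iff.rfl`)
only because the port landed the same hour; nothing else changes.  `Cylindrical` / `weight` stay local (rev-3 names used by the closed
S1 wiring and by every registered signature) and are bridged to the port's bundled forms by `isSplitDecomposition_iff` /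
`laplaceWeight_eq_weight` (both `Iff.rfl` / `rfl`). -/

open Summit.ValiantsHypothesis.ValiantsHypothesis.Theorems.RigidityForcesSymmetryRankRigidMinimalRepr.LaplaceFiveSectorSplit
  (SlotInvariantOn SideSymmetric IsSplitDecomposition laplaceWeight SideSymLaplaceOptimalFive AsymLaplaceOptimalFive)

/-- The port's bundled hypothesis is the line's `Cylindrical ∧ exact` (definitional). -/
theorem isSplitDecomposition_iff {N : ℕ} (T : Finset (Fin N)) (S : Fin N → Finset (Fin 5))
    (u w : Fin N → (Fin 5 → Fin 5) → ℂ) :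
    IsSplitDecomposition T S u w ↔
      (Cylindrical S u w ∧ ∀ v : Fin 5 → Fin 5, (∑ t ∈ T, u t v * w t v) = if Function.Injective v then 1 else 0) := by
  unfold IsSplitDecomposition Cylindrical
  exact ⟨fun h => ⟨⟨h.1, h.2.1⟩, h.2.2⟩, fun h => ⟨h.1.1, h.1.2, h.2⟩⟩

/-- The port's `laplaceWeight` is the line's `weight` (definitional). -/
theorem laplaceWeight_eq_weight {N : ℕ} (T : Finset (Fin N)) (S : Fin N → Finset (Fin 5)) :
    laplaceWeight T S = weight T S := rfl

/-- WEIGHT-MINIMAL profile: no exact cylindrical term system for `P₅`, on any number of terms and any profile, has smaller Laplace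
weight than `(T, S)`.  This is the padding-stable normal form of rev 4: every padding that raises the weight (inert cancelling pair
+24, the rewriting `f⊗g ↦ f⊗(g+h) + (−f)⊗h` +12, net cut-junk through a doubly-cylindrical function on two splits +24) destroys it,
and a zero-cost block gauge cannot change which sector a weight-minimal system is in (blocks have full rank at the minimum). -/
def WeightMinimal {N : ℕ} (T : Finset (Fin N)) (S : Fin N → Finset (Fin 5)) : Prop :=
  ∀ (N' : ℕ) (T' : Finset (Fin N')) (S' : Fin N' → Finset (Fin 5)) (u' w' : Fin N' → (Fin 5 → Fin 5) → ℂ),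
    Cylindrical S' u' w' →
    (∀ v : Fin 5 → Fin 5, (∑ t ∈ T', u' t v * w' t v) = if Function.Injective v then 1 else 0) →
    weight T S ≤ weight T' S'

/-- A slot permutation fixing the complement of `A` pointwise maps `A` onto itself. -/
theorem image_perm_eq_of_fix_compl (A : Finset (Fin 5)) (τ : Equiv.Perm (Fin 5)) (hτ : ∀ i, i ∉ A → τ i = i) :
    A.image ⇑τ = A := by
  apply Finset.eq_of_subset_of_card_le
  · intro j hj
    rw [Finset.mem_image] at hj
    obtain ⟨i, hi, rfl⟩ := hj
    by_contra h
    have h1 : τ (τ i) = τ i := hτ (τ i) h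
    have h2 : τ i = i := τ.injective h1
    rw [h2] at h
    exact h hi
  · rw [Finset.card_image_of_injective _ τ.injective]

/-- Hence the letters read on `A` do not change under such a permutation. -/
theorem image_comp_perm_eq (A : Finset (Fin 5)) (τ : Equiv.Perm (Fin 5)) (hτ : ∀ i, i ∉ A → τ i = i) (v : Fin 5 → Fin 5) :
    A.image (v ∘ ⇑τ) = A.image v := by
  rw [← Finset.image_image, image_perm_eq_of_fix_compl A τ hτ]

/-- **ON-SHELL ⟹ SIDE-SYMMETRIC (proved): S1's case sits inside the symmetric sector** (director R280 (1) «S1 ⊂ SideSym sector»).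
An on-shell factor depends only on the letter set read on its side, which a slot permutation of that side does not change. -/
theorem sideSymmetric_of_onShell {N : ℕ} (T : Finset (Fin N)) (S : Fin N → Finset (Fin 5))
    (u w : Fin N → (Fin 5 → Fin 5) → ℂ) (h : OnShell T S u w) : SideSymmetric T S u w := by
  intro t ht
  refine ⟨fun τ hτ v => ?_, fun τ hτ v => ?_⟩
  · exact h.2.1 t ht (v ∘ ⇑τ) v (image_comp_perm_eq (S t) τ hτ v)
  · exact h.2.2.2 t ht (v ∘ ⇑τ) v (image_comp_perm_eq (S t)ᶜ τ hτ v)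

/-- **S2′ — `stub_sideSym_offShell_five` (rev 4; rank 2 of the line = the instrumented stub; size L; PARITY-SENSITIVE).**  A
cylindrical term system that reproduces `P₅` exactly, is SIDE-SYMMETRIC on `T` and is NOT on-shell on `T` has Laplace weight `≥ 120`.
Equivalently (given the closed S1, `sideSymLO5_of_S1_S2'` / `S2'_of_sideSymLO5` below): young-shadow K1 `SideSymLaplaceOptimalFive` —
the whole symmetric sector is expensive.  MECHANISM OF RECORD (crux idea #6 `Ideas/young-shadow.md`, crit-3 PASS-WITH-PRICE rank 2/6):
write each term's contribution through the Young-invariant vectors `ξ^λ_S` (`λ ∈ {(4,1),(3,2)}`) of its split; on RIGID supports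
(every set of ≤ 3 pair splits, paw, chair, path: no relations among the `ξ^λ_S`) separation forces every shadow `Z_S` to be fully
`S₅`-symmetric and the catalecticant `rank Cat_{2,3}(x₀⋯x₄) = 10` gives ≥ 10 terms; on SLACK supports (star `K_{1,4}`, `C₄`, `K₃ ⊔ K₂`,
≥ 5 splits) the relation moduli `Rel^λ(G)` enter, and THAT is where `d` enters (crit-3 g4 verdict P1, 16:55:21Z: PROP A =
separation(≤ 3) + needTen is a PARITY-BLIND rung — its `d = 6` twin holds, ≤ 3 half-split flattenings being rigid at `d = 6` too with
cost ≥ `rank Cat_{3,3}(x₀⋯x₅)·36 = 720`; the weight-648 design is a SLACK-support symmetric design) — first targets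
`stub_threeSplit_separation`, `stub_symmetricPieces_needTen`, `stub_sideSym_threePairSplits` of `YoungShadowSketch.lean` (val-lit-p4
g14 scratch per R282 (2)(d); land `--supports stmt-ValiantsHypothesis-24813`); CHEAPEST FALSIFIER (crit-3 P2, run first, val-lit-p8):
a side-symmetric exact design of weight < 120 on the STAR support `K_{1,4}` (smallest slack support, one `(3,2)`-relation
`Σ_j ξ³²_{0j} = 0`) kills S2′ and the crux; an empty fibre proves the star case; then `C₄`, `K₃ ⊔ K₂`.  WHY IT MIGHT CLOSE WITH CLOSED TOOLS: no certified border family is side-symmetric (p629937 lives in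
the asymmetric sector, `YoungShadowSketch.shadowLead12_witness`; val-neg-2 kit j313482: no symmetric-sector border obstruction at
resolution F3-sym 5/5), so S2′ is plausibly border-TRUE and rank / flattening arguments are legitimate here.  WHY IT MIGHT FAIL: a
cheap side-symmetric exact identity at `d = 5` on a slack support (≥ 5 pair splits, where `Rel^λ(G) ≠ 0`) — none known.  PADDING
TEST: `SideSymmetric` cannot be manufactured; `¬ OnShell` can (symmetric inert pair `±[v₀=v₁] ⊗ 1`, +24) but only yields «symmetric
on-shell ≥ 96» ⊂ S1 ✓ — no costume content.  d = 6 CALIBRATION: the analogue is FALSE (the weight-648 exact design is side-symmetric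
and off-shell) — this stub must see that 5 is odd, and by P1 it can only do so on slack supports.  SIGN CALIBRATION: the `D₅`-instance is VACUOUS (`D₅` has no side-symmetric
split decomposition: sign projector), consistent with `SignBlindBarrier.signBlind_le_72`.  Sources: `Ideas/young-shadow.md` K1;
`YoungShadowSketch.lean` @03c74d92d6ab; `…LaplaceFiveSectorSplit(Defs)` (w1 port); Ranestad–Schreyer / Carlini–Catalisano–Geramita
for `Cat_{2,3}`; `LaplaceSixExact.not_laplaceOptimal_six` (p643716).

LOCATED RESIDUAL (rev 4′; crit-3 g4 census 18:17:29Z, exact — `ys/ksplit.py`; director R286 (1)).  For a family `F` of `k` distinct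
pair splits and a content class `O` (an `S₅`-orbit of words) put `slack(F,O) := Σ_{S ∈ F} (dim Inv(G_S)|_O − 1) + 1 − dim(Σ_{S ∈ F}
Inv(G_S)|_O) ≥ 0` (`G_S` = the Young subgroup `Sym(S) × Sym(Sᶜ)` acting on slots); SEPARATION «each `Z_S` `G_S`-invariant and
`Σ_S Z_S` fully symmetric ⇒ each `Z_S` fully symmetric» holds on `O` iff `slack(F,O) = 0` — `slack` is the dimension of the RELATION
MODULI (first syzygies among the invariant shadow spaces modulo the trivial ones among constants).  CENSUS: `k ≤ 3`: slack 0 for all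
types and all 126 classes (= the closed separation sub-rungs above); `k = 4`: separation HOLDS for the types `P₅`-path, chair, paw (180
families, all classes) and FAILS exactly for the star `K₁,₄` (slack 5 on the injective class; > 0 on 101/126 classes), `C₄` (4; 121/126),
`K₃ ⊔ K₂` (9; 121/126); `k ≥ 5`: FAILS for every type (injective-class slack `k=5`: 4 or 9 · `k=6`: 13 or 18 · `k=7`: 22 · `k=8`: 31 ·
`k=9`: 40 · `k=10`: 49 — the ten `Inv(G_pair)` span only the 42-dimensional `(5) ⊕ (4,1) ⊕ (3,2)`-isotypic part of the regular module).
CONSEQUENCE FOR THIS STUB: Prop A (≤ 3 distinct pair splits, ✓ p657029) extends for free to «≤ 4 distinct pair splits of type `P₅`-path / chair / paw»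
(Prop A⁺ — a THEOREM since rev 5: ✓ p662460 `LaplaceFivePropA.sideSym_fourPairSplits_rigid` over ✓ p661673
`LaplaceFiveFourSplit.fourSplit_separation_rigid`, val-lit-p4 g14); beyond that — `K₁,₄`, `C₄`, `K₃ ⊔ K₂`, every support with ≥ 5 pair splits, and in
particular honest Laplace itself (all ten splits, slack 49) — the mechanism «shadows are individually symmetric» is DEAD, and S2′'s
bulk needs an argument that PRICES THE RELATION MODULI (a lower bound on the weight of an exact side-symmetric system as a function of
its relation tuple), not separation.  TYPED OBJECTS OF RECORD (rev 5; 24813-w1 g3, R286 (1)(ii), all ✓ in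
namespace `LaplaceFiveSectorSplit`, files `…LaplaceFiveFourSplitSlack{Defs,}` / `…LaplaceFiveSlackCoherence`): the slack tensors `star_slack`, `cycle_slack`,
`triangleEdge_slack₄₁/₃₂` with `not_fourSplit_separation_star / _cycle / _triangleEdge` (✓ p658198 / p658812), and the coherence laws
`star_coherence` / `triangleEdge_coherence` / `cycle_antipodal_coherence` (✓ p659292 / p659453).  THE STAR, REDUCED (rev 5 header (ii);
memos `NOTE-w1g3-24813-star-K1-reduction.md`, `NOTE-g7-24813-star-closed-rays.md`): a side-symmetric star decomposition with hub `p` IS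
(f₁,…,f₄; E), `Σ f_a = x₀⋯x₄`, ONE common `E ∈ S₍₃,₂₎ ⊂ Sym²⊗Sym³`, ray `a` = transport of `Cat₂,₃ f_a + E`; K1-on-the-star ⟺
`Σ_a rank(Cat₂,₃ f_a + E) ≥ 10` for all such tuples (a Σ ≤ 9 tuple would be a weight-108 EXACT decomposition and refute the crux);
the one-flattening bound is dead at rank 4 (`E*`), so the four-way splitting must be used; pen architecture L1–L5 with L2 (closed
rank-2 rays have a square in their pencil) the open algebra.  NEXT RUNG (named 19:24:16Z, crit-3 no objection, R292 (6)):
`LaplaceFivePropA.sideSym_starPairSplits … (p : Fin 5) (hstar : ∀ t ∈ T, p ∈ S t) : Nat.factorial 5 ≤ laplaceWeight T S`; then `C₄`,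
`K₃ ⊔ K₂`, ≥ 5 splits.  Candidate pricing device on record
(crux idea #7 `ghost-ledger`, val-idea-19 g7, `Cruxes/LaplaceOptimalFive/Ideas/ghost-ledger.md`: relations among generator spaces
↦ born generators of the flat-limit configuration ideal, charged at Laplace cost) — an IDEA, not a proof; nothing in this stub depends
on it.  Slack > 0 says only that the catalecticant count cannot be applied shadow by shadow; it does not bear on the truth of S2′. -/
theorem stub_sideSym_offShell_five :
    ∀ (N : ℕ) (T : Finset (Fin N)) (S : Fin N → Finset (Fin 5)) (u w : Fin N → (Fin 5 → Fin 5) → ℂ),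
      Cylindrical S u w →
      (∀ v : Fin 5 → Fin 5, (∑ t ∈ T, u t v * w t v) = if Function.Injective v then 1 else 0) →
      SideSymmetric T S u w → ¬ OnShell T S u w →
      Nat.factorial 5 ≤ weight T S := by
  sorry

/-- **S3′ — `stub_minimalAsym_five` (rev 4; RESIDUAL LAW — honestly labelled; rank 3 of the line; 0 provers until a mechanism is
typed; SIGN-SENSITIVE).**  A cylindrical term system that reproduces `P₅` exactly, whose profile is WEIGHT-MINIMAL among all exact
cylindrical systems, and which is NOT side-symmetric, has Laplace weight `≥ 120`.  In words: asymmetry never pays at the weight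
minimum.  CONTENT: this is the crux's asymmetric sector restricted to minimizers — the sector of every certified cheap mechanism at
`d = 5` (the border family p629937, the idle-slot / star border classes) — and NO mechanism is claimed for it here; it is registered so
that the composition is honest about what remains after S1 and S2′, exactly as the 5906 `stub_residual` pattern.  It is WEAKER than
young-shadow K2 (`S3'_of_asymLO5`: `AsymLaplaceOptimalFive` ⟹ S3′) and a consequence of the crux (`S3'_of_laplaceOptimalFive`).  What a
mechanism would have to be (crit-3 16:22:41Z, the rev-5 (q) admission test): a quantitative invariant of the per-flattening junk
`J_F = Σ_{t on F} u_t ⊗ w_t` modulo doubly-cylindrical functions, taking the same value on `X`, `X ⊕ {t₊,t₋}`, `r1(X)`, `r2(X)`;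
young-shadow's normal form «the shadows solve a flux-perturbed symmetric problem, `Σ_S ι_S Z_S = P₅ − F`» is the only structure on
record.  WHY IT MIGHT FAIL: it fails iff the crux fails with an asymmetric minimizer — i.e. iff some LM tail profile (star
`3·01+2·02+2·03+2·04`, `2·01 + {02,03,04,12,13,14}`, triangle `3·01+3·02+3·12`, …; val-lit-p8 g12 census) carries an honest
decomposition.  PADDING TEST: passes t±, r1, r2 (each raises the weight, destroying `WeightMinimal`) and block gauge (full-rank blocks
at the minimum keep `span{u_t}`; symmetry of a span is gauge-invariant).  d = 6 CALIBRATION: hypothesis `¬ SideSymmetric` is NOT met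
by the weight-648 design (side-symmetric), so `not_laplaceOptimal_six` does not contradict the analogue, which is plausibly TRUE at
even `d`.  SIGN CALIBRATION: the `D₅`-instance is FALSE — `D₅`'s weight-72 minimizers (`SignPatternCheap.sign_five_cheap`, p646934)
are necessarily asymmetric since `D₅` has no side-symmetric decomposition — so any proof must use the signs of `P₅`
(`SignBlindBarrier`, p650988).  Sources: `Ideas/young-shadow.md` K2; `…LaplaceFiveSectorSplitDefs` docstring of
`AsymLaplaceOptimalFive` (costume-on-`[72,96)` label of the unrestricted sector, removed here by minimality);
`Negative.DepthOnePadding` (p648754); `Negative.LaplaceFiveBorder` (p629937). -/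
theorem stub_minimalAsym_five :
    ∀ (N : ℕ) (T : Finset (Fin N)) (S : Fin N → Finset (Fin 5)) (u w : Fin N → (Fin 5 → Fin 5) → ℂ),
      Cylindrical S u w →
      (∀ v : Fin 5 → Fin 5, (∑ t ∈ T, u t v * w t v) = if Function.Injective v then 1 else 0) →
      WeightMinimal T S → ¬ SideSymmetric T S u w →
      Nat.factorial 5 ≤ weight T S := by
  sorry

/-- The weights realised by exact cylindrical term systems for `P₅` (the set the composition minimises over). -/
def IsExactWeight (n : ℕ) : Prop :=
  ∃ (N : ℕ) (T : Finset (Fin N)) (S : Fin N → Finset (Fin 5)) (u w : Fin N → (Fin 5 → Fin 5) → ℂ),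
    Cylindrical S u w ∧
    (∀ v : Fin 5 → Fin 5, (∑ t ∈ T, u t v * w t v) = if Function.Injective v then 1 else 0) ∧
    weight T S = n

/-- **COMPOSITION (kernel-checked modulo S2′, S3′; S1 closed): S1 ∧ S2′ ∧ S3′ ⟹ `LaplaceOptimalFive`, by MINIMAL COUNTEREXAMPLE.**
Given any exact cylindrical system, `Nat.find` produces a weight-minimal exact cylindrical system `X₀`, cheaper or equal; `X₀` is
on-shell (S1, closed), or side-symmetric off-shell (S2′), or not side-symmetric (S3′) — in each case its weight is `≥ 120`.  Every
registered stub is load-bearing.  The conclusion is the route decl BY NAME (`= LaplaceOptimal 5`, `Iff.rfl`). -/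
theorem LaplaceOptimalFive_of :
    Summit.ValiantsHypothesis.ValiantsHypothesis.Theses.RigidityForcesSymmetry.LaplaceOptimalFive := by
  classical
  intro N T S u w hu hw hid
  have hX : IsExactWeight (weight T S) := by
    unfold IsExactWeight
    exact ⟨N, T, S, u, w, ⟨hu, hw⟩, hid, rfl⟩
  have hex : ∃ n, IsExactWeight n := ⟨weight T S, hX⟩
  have hspec := Nat.find_spec hex
  unfold IsExactWeight at hspec
  obtain ⟨N₀, T₀, S₀, u₀, w₀, hcyl₀, hid₀, hwt₀⟩ := hspec
  have hmin : WeightMinimal T₀ S₀ := by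
    intro N' T' S' u' w' hcyl' hid'
    have hP : IsExactWeight (weight T' S') := by
      unfold IsExactWeight
      exact ⟨N', T', S', u', w', hcyl', hid', rfl⟩
    rw [hwt₀]
    exact Nat.find_min' hex hP
  have h120 : Nat.factorial 5 ≤ weight T₀ S₀ := by
    by_cases hon : OnShell T₀ S₀ u₀ w₀
    · exact stub_onShell_five N₀ T₀ S₀ u₀ w₀ hcyl₀ hon hid₀
    · by_cases hsym : SideSymmetric T₀ S₀ u₀ w₀
      · exact stub_sideSym_offShell_five N₀ T₀ S₀ u₀ w₀ hcyl₀ hid₀ hsym hon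
      · exact stub_minimalAsym_five N₀ T₀ S₀ u₀ w₀ hcyl₀ hid₀ hmin hsym
  exact le_trans h120 (hmin N T S u w ⟨hu, hw⟩ hid)

/-! ### By-name compatibility with the sector split (all proved) -/

/-- young-shadow K1 (`SideSymLaplaceOptimalFive`, unbundled) ⟹ S2′ (drop the off-shell hypothesis). -/
theorem S2'_of_sideSymLO5
    (hK1 : ∀ (N : ℕ) (T : Finset (Fin N)) (S : Fin N → Finset (Fin 5)) (u w : Fin N → (Fin 5 → Fin 5) → ℂ),
      Cylindrical S u w →
      (∀ v : Fin 5 → Fin 5, (∑ t ∈ T, u t v * w t v) = if Function.Injective v then 1 else 0) →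
      SideSymmetric T S u w → Nat.factorial 5 ≤ weight T S) :
    ∀ (N : ℕ) (T : Finset (Fin N)) (S : Fin N → Finset (Fin 5)) (u w : Fin N → (Fin 5 → Fin 5) → ℂ),
      Cylindrical S u w →
      (∀ v : Fin 5 → Fin 5, (∑ t ∈ T, u t v * w t v) = if Function.Injective v then 1 else 0) →
      SideSymmetric T S u w → ¬ OnShell T S u w →
      Nat.factorial 5 ≤ weight T S :=
  fun N T S u w hc hid hs _ => hK1 N T S u w hc hid hs

/-- S1 ∧ S2′ ⟹ young-shadow K1 (unbundled): the symmetric sector is the closed on-shell case plus S2′. -/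
theorem sideSymLO5_of_S1_S2'
    (hS1 : ∀ (N : ℕ) (T : Finset (Fin N)) (S : Fin N → Finset (Fin 5)) (u w : Fin N → (Fin 5 → Fin 5) → ℂ),
      Cylindrical S u w → OnShell T S u w →
      (∀ v : Fin 5 → Fin 5, (∑ t ∈ T, u t v * w t v) = if Function.Injective v then 1 else 0) →
      Nat.factorial 5 ≤ weight T S)
    (hS2 : ∀ (N : ℕ) (T : Finset (Fin N)) (S : Fin N → Finset (Fin 5)) (u w : Fin N → (Fin 5 → Fin 5) → ℂ),
      Cylindrical S u w →
      (∀ v : Fin 5 → Fin 5, (∑ t ∈ T, u t v * w t v) = if Function.Injective v then 1 else 0) →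
      SideSymmetric T S u w → ¬ OnShell T S u w →
      Nat.factorial 5 ≤ weight T S) :
    ∀ (N : ℕ) (T : Finset (Fin N)) (S : Fin N → Finset (Fin 5)) (u w : Fin N → (Fin 5 → Fin 5) → ℂ),
      Cylindrical S u w →
      (∀ v : Fin 5 → Fin 5, (∑ t ∈ T, u t v * w t v) = if Function.Injective v then 1 else 0) →
      SideSymmetric T S u w → Nat.factorial 5 ≤ weight T S := by
  intro N T S u w hc hid hs
  by_cases hon : OnShell T S u w
  · exact hS1 N T S u w hc hon hid
  · exact hS2 N T S u w hc hid hs hon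

/-- Unconditionally in S1 (closed ✓ p652503): S2′ ⟹ young-shadow K1. -/
theorem sideSymLO5_of_S2'
    (hS2 : ∀ (N : ℕ) (T : Finset (Fin N)) (S : Fin N → Finset (Fin 5)) (u w : Fin N → (Fin 5 → Fin 5) → ℂ),
      Cylindrical S u w →
      (∀ v : Fin 5 → Fin 5, (∑ t ∈ T, u t v * w t v) = if Function.Injective v then 1 else 0) →
      SideSymmetric T S u w → ¬ OnShell T S u w →
      Nat.factorial 5 ≤ weight T S) :
    ∀ (N : ℕ) (T : Finset (Fin N)) (S : Fin N → Finset (Fin 5)) (u w : Fin N → (Fin 5 → Fin 5) → ℂ),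
      Cylindrical S u w →
      (∀ v : Fin 5 → Fin 5, (∑ t ∈ T, u t v * w t v) = if Function.Injective v then 1 else 0) →
      SideSymmetric T S u w → Nat.factorial 5 ≤ weight T S :=
  sideSymLO5_of_S1_S2' stub_onShell_five hS2

/-- young-shadow K2 (`AsymLaplaceOptimalFive`, unbundled) ⟹ S3′ (drop minimality): S3′ is WEAKER than the unrestricted sector. -/
theorem S3'_of_asymLO5
    (hK2 : ∀ (N : ℕ) (T : Finset (Fin N)) (S : Fin N → Finset (Fin 5)) (u w : Fin N → (Fin 5 → Fin 5) → ℂ),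
      Cylindrical S u w →
      (∀ v : Fin 5 → Fin 5, (∑ t ∈ T, u t v * w t v) = if Function.Injective v then 1 else 0) →
      ¬ SideSymmetric T S u w → Nat.factorial 5 ≤ weight T S) :
    ∀ (N : ℕ) (T : Finset (Fin N)) (S : Fin N → Finset (Fin 5)) (u w : Fin N → (Fin 5 → Fin 5) → ℂ),
      Cylindrical S u w →
      (∀ v : Fin 5 → Fin 5, (∑ t ∈ T, u t v * w t v) = if Function.Injective v then 1 else 0) →
      WeightMinimal T S → ¬ SideSymmetric T S u w →
      Nat.factorial 5 ≤ weight T S :=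
  fun N T S u w hc hid _ hns => hK2 N T S u w hc hid hns

/-- HONESTY (proved): S3′ is a consequence of the crux (a sector at the minimum, not a strengthening). -/
theorem S3'_of_laplaceOptimalFive
    (h : Summit.ValiantsHypothesis.ValiantsHypothesis.Theses.RigidityForcesSymmetry.LaplaceOptimalFive) :
    ∀ (N : ℕ) (T : Finset (Fin N)) (S : Fin N → Finset (Fin 5)) (u w : Fin N → (Fin 5 → Fin 5) → ℂ),
      Cylindrical S u w →
      (∀ v : Fin 5 → Fin 5, (∑ t ∈ T, u t v * w t v) = if Function.Injective v then 1 else 0) →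
      WeightMinimal T S → ¬ SideSymmetric T S u w →
      Nat.factorial 5 ≤ weight T S :=
  fun N T S u w hc hid _ _ => h N T S u w hc.1 hc.2 hid

/-- HONESTY (proved): so is S2′. -/
theorem S2'_of_laplaceOptimalFive
    (h : Summit.ValiantsHypothesis.ValiantsHypothesis.Theses.RigidityForcesSymmetry.LaplaceOptimalFive) :
    ∀ (N : ℕ) (T : Finset (Fin N)) (S : Fin N → Finset (Fin 5)) (u w : Fin N → (Fin 5 → Fin 5) → ℂ),
      Cylindrical S u w →
      (∀ v : Fin 5 → Fin 5, (∑ t ∈ T, u t v * w t v) = if Function.Injective v then 1 else 0) →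
      SideSymmetric T S u w → ¬ OnShell T S u w →
      Nat.factorial 5 ≤ weight T S :=
  fun N T S u w hc hid _ _ => h N T S u w hc.1 hc.2 hid

/-! ### Rev 4′ by-name wires to the port's bundled sector Props (all proved; `open … LaplaceFiveSectorSplit`) -/

/-- K1 of the port (`SideSymLaplaceOptimalFive`, bundled) ⟹ S2′. -/
theorem S2'_of_K1 (hK1 : SideSymLaplaceOptimalFive) :
    ∀ (N : ℕ) (T : Finset (Fin N)) (S : Fin N → Finset (Fin 5)) (u w : Fin N → (Fin 5 → Fin 5) → ℂ),
      Cylindrical S u w →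
      (∀ v : Fin 5 → Fin 5, (∑ t ∈ T, u t v * w t v) = if Function.Injective v then 1 else 0) →
      SideSymmetric T S u w → ¬ OnShell T S u w →
      Nat.factorial 5 ≤ weight T S := by
  intro N T S u w hc hid hs _
  have h := hK1 N T S u w ((isSplitDecomposition_iff T S u w).2 ⟨hc, hid⟩) hs
  rwa [laplaceWeight_eq_weight] at h

/-- S2′ ⟹ K1 of the port (bundled), unconditionally in the closed S1 (✓ p652503): a Theorems proof of either closes the other. -/
theorem K1_of_S2'
    (hS2 : ∀ (N : ℕ) (T : Finset (Fin N)) (S : Fin N → Finset (Fin 5)) (u w : Fin N → (Fin 5 → Fin 5) → ℂ),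
      Cylindrical S u w →
      (∀ v : Fin 5 → Fin 5, (∑ t ∈ T, u t v * w t v) = if Function.Injective v then 1 else 0) →
      SideSymmetric T S u w → ¬ OnShell T S u w →
      Nat.factorial 5 ≤ weight T S) :
    SideSymLaplaceOptimalFive := by
  intro N T S u w hdec hs
  obtain ⟨hc, hid⟩ := (isSplitDecomposition_iff T S u w).1 hdec
  rw [laplaceWeight_eq_weight]
  exact sideSymLO5_of_S2' hS2 N T S u w hc hid hs

/-- K2 of the port (`AsymLaplaceOptimalFive`, bundled; the labelled residual of the sector split) ⟹ S3′. -/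
theorem S3'_of_K2 (hK2 : AsymLaplaceOptimalFive) :
    ∀ (N : ℕ) (T : Finset (Fin N)) (S : Fin N → Finset (Fin 5)) (u w : Fin N → (Fin 5 → Fin 5) → ℂ),
      Cylindrical S u w →
      (∀ v : Fin 5 → Fin 5, (∑ t ∈ T, u t v * w t v) = if Function.Injective v then 1 else 0) →
      WeightMinimal T S → ¬ SideSymmetric T S u w →
      Nat.factorial 5 ≤ weight T S := by
  intro N T S u w hc hid _ hns
  have h := hK2 N T S u w ((isSplitDecomposition_iff T S u w).2 ⟨hc, hid⟩) hns
  rwa [laplaceWeight_eq_weight] at h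

/-- Sanity (rev 4′): the port's sector recombination gives the crux from the two bundled Props, by name. -/
example (h1 : SideSymLaplaceOptimalFive) (h2 : AsymLaplaceOptimalFive) :
    Summit.ValiantsHypothesis.ValiantsHypothesis.Theses.RigidityForcesSymmetry.LaplaceOptimalFive :=
  Summit.ValiantsHypothesis.ValiantsHypothesis.Theorems.RigidityForcesSymmetryRankRigidMinimalRepr.LaplaceFiveSectorSplit.laplaceOptimalFive_of_sectors
    h1 h2

/-! ### WITHDRAWN in rev 4 (memo — NOT registered stubs; text of record in `Lines/shallow_collision.md` § «Withdrawn mechanisms»)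

* rev-3 S2 `stub_offShell_oddSurfacing_five` (g3 K1 restricted to off-shell systems: a cheap exact off-shell system has a term
  with DEPTH-ONE CUT-JUNK) and rev-3 S3 `stub_depthOneUncancellable_five` (g3 K2: depth-one cut-junk cannot be cancelled below 120)
  — S3 STUB-MISSTATED of record (✓ p648754 `…Negative.DepthOnePadding.below96_of_depthOneUncancellable`, val-neg-2 g2; crit-3 g4
  16:22:41Z): the feature premise is manufactured by an inert cancelling pair.  Their mechanism (`TwinSpanDepth.mirror_identity`,
  `fat_emits_junk`, `pair_depth_dichotomy`; the cleaning-capacity count `m_{pq} + 4 n_{pq}` vs `24` equations per letter) returns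
  as a rev-5 stub only in (q) form: a padding-stable quantitative invariant of the per-flattening junk `J_F` modulo doubly-cylindrical
  functions — it would then REPLACE S3′.
* rev-3 `offShell_oddSurfacing_of_oddSurfacing` (sanity lemma about S2) — moot.
-/

end Summit.ValiantsHypothesis.ValiantsHypothesis.Cruxes.LaplaceOptimalFive.ShallowCollision
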